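/-
Copyright (c) 2026. All rights reserved.
Released under Apache 2.0 license as described in the file LICENSE.
Authors: abc-iut cell, prover seat abc-iut-L4-t12 (gen 7).
-/
import Literature.AnabelianGeometry.AbsoluteAnabelian.ArchimedeanHolFieldFunctorGeometricOverIdRigid
import Literature.Topology.CoveringSpaces.CoveringConnectedIdRigid
import Literature.AlgebraicTopology.Homotopy.ManifoldStronglyLocallyContractible
import Mathlib.Topology.Connected.LocallyPathConnected
import HarnessLib

/-!
# [AbsTopIII] Prop 4.2 (i), geometric column: the slice of `HolRS` over `𝕏` is id-rigid when
# `Z(π̂₁(𝕏^top)) = 1`; unconditionally over the thrice-punctured sphere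

PROOF-ONLY instances (abc-iut cell, campaign-L item R1.2 of the `EA` column of [AbsTopIII] Prop 4.2 /
Cor 4.5; classical) of the reduction `HolRS.isIdRigid_over_of_isIdRigid_connectedCover`
(`ArchimedeanHolFieldFunctorGeometricOverIdRigid.lean`, (H2) of print's «the full subcategory of `EA`
consisting of objects that map to `X` … [is id-rigid by] the slimness assertion of Lemma 4.3»,
S. Mochizuki, *Topics in Absolute Anabelian Geometry III*, kurims p.106 l.11–19), now that the cell's
(3ε) «the CONNECTED finite covering spaces of `X` form an id-rigid category whenever the profinite
completion of `π₁(X, x₀)` is centre-free» is in the tree (abc-iut-L6-t18,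
`Literature/Topology/CoveringSpaces/CoveringConnectedIdRigid.lean`,
`CovFin.isIdRigid_connected_of_center_eq_bot`):

* `HolRS.pathConnectedSpace_carrier`, `HolRS.stronglyLocallyContractibleSpace_carrier` — a connected
  Riemann surface is path connected and strongly locally contractible (hypotheses of the topological
  Galois correspondence);
* **`HolRS.isIdRigid_over_of_center_eq_bot`**, `HolRS.isIdRigid_over_of_isSlimGroup` — for EVERY
  connected Riemann surface `𝕏` with `Z(π̂₁(𝕏^top, x₀)) = 1` (e.g. `π̂₁` slim), the slice `Over 𝕏` of
  `HolRS` — connected Riemann surfaces holomorphic finite étale over `𝕏`, morphisms over `𝕏` — is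
  id-rigid;
* `HolRS.planeComplFinite F hF`, **`HolRS.isIdRigid_over_planeComplFinite`**,
  **`HolRS.isIdRigid_over_thricePuncturedSphere`** — UNCONDITIONALLY: for `F ⊆ ℂ` finite with
  `2 ≤ |F|`, in particular for `ℙ¹ ∖ {0, 1, ∞} = ℂ ∖ {0, 1}`, every automorphism of the identity functor
  of the category of connected holomorphic finite étale covers of `ℂ ∖ F` over `ℂ ∖ F` is trivial
  (abc-iut-w5-d144's `π₁(ℂ ∖ F) ≅ F_{|F|}` + slimness of free profinite groups, via (3ε));
* `HolRS.isIdRigid_mapsTo_planeComplFinite_of` — hence, for `Q` closed under finite étale covers and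
  containing `ℂ ∖ F`, «objects of `EA^hol_RS(Q)` mapping to `ℂ ∖ F`» is id-rigid as soon as (H1)
  holds at `ℂ ∖ F` (an automorphism commuting with all holomorphic finite étale endomorphisms is the
  identity — for `ℂ ∖ {0,1}`: `Aut = 𝔖₃` is centre-free, classification not in the tree): the ONE
  remaining input of print's Prop 4.2 (i) at this object of the geometric model.

HONEST SCOPE: slice / model level; (H1) stays a hypothesis; orbicurves and uniformisation untouched;
nothing here bears on [IUTchIII] Cor. 3.12.  One packaging `def` (`HolRS.planeComplFinite`); no
instances, no Prop facts.

## References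

* S. Mochizuki, *Topics in Absolute Anabelian Geometry III*, kurims ms, proof of Prop 4.2 (i) p.106
  l.11–19; Lemma 4.3 p.106. [MochizukiAbsTopIII2015]
-/

noncomputable section

open CategoryTheory Set Topology TopologicalSpace
open Literature.AlgebraicGeometry.Frobenioids (IsSlimGroup)
open Literature.IUT.HodgeTheaters (profiniteCompletion)
open Literature.Topology.CoveringSpaces Literature.AlgebraicTopology.Homotopy

namespace Literature.AnabelianGeometry.AbsoluteAnabelian

namespace HolRS

/-! ### §1 Every connected Riemann surface satisfies the hypotheses of the Galois correspondence -/

/-- A connected Riemann surface is path connected (connected and locally path connected, being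
charted over `ℂ`). [cite: MochizukiAbsTopIII2015, Definition 4.1 (i) p.101] -/
theorem pathConnectedSpace_carrier (X : HolRS) : PathConnectedSpace X.carrier := by
  haveI : LocallyPathConnectedSpace X.carrier := ChartedSpace.locallyPathConnectedSpace ℂ X.carrier
  exact pathConnectedSpace_iff_connectedSpace.2 X.connectedSpace

/-- A connected Riemann surface is strongly locally contractible (a manifold modelled on the real
normed space `ℂ`). [cite: MochizukiAbsTopIII2015, Definition 4.1 (i) p.101] -/
theorem stronglyLocallyContractibleSpace_carrier (X : HolRS) : StronglyLocallyContractibleSpace X.carrier :=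
  stronglyLocallyContractibleSpace_of_chartedSpace_normedSpace ℂ X.carrier

/-! ### §2 The slice over `𝕏` is id-rigid when `Z(π̂₁(𝕏^top)) = 1` -/

/-- **The slice of `HolRS` over `𝕏` is id-rigid when the profinite completion of `π₁(𝕏^top, x₀)` is
centre-free**: every automorphism of the identity functor of the category of connected Riemann
surfaces holomorphic finite étale over `𝕏` (morphisms over `𝕏`) is trivial — (H2) of the EA column,
discharged from (3ε) (`CovFin.isIdRigid_connected_of_center_eq_bot`) through
`Over 𝕏 ≌ {connected finite covers of 𝕏^top}`. [cite: MochizukiAbsTopIII2015, Proposition 4.2 (i) p.106] -/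
theorem isIdRigid_over_of_center_eq_bot (X : HolRS) (x₀ : X.carrier)
    (hZ : Subgroup.center (profiniteCompletion (FundamentalGroup X.carrier x₀)) = ⊥) :
    IsIdRigid (Over X) := by
  haveI := X.pathConnectedSpace_carrier
  haveI := X.stronglyLocallyContractibleSpace_carrier
  exact X.isIdRigid_over_of_isIdRigid_connectedCover (CovFin.isIdRigid_connected_of_center_eq_bot x₀ hZ)

/-- **The slice of `HolRS` over `𝕏` is id-rigid when `π̂₁(𝕏^top, x₀)` is slim** (print's Lemma 4.3
input: slim ⇒ centre-free). [cite: MochizukiAbsTopIII2015, Lemma 4.3 p.106] -/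
theorem isIdRigid_over_of_isSlimGroup (X : HolRS) (x₀ : X.carrier)
    (h : IsSlimGroup (profiniteCompletion (FundamentalGroup X.carrier x₀))) :
    IsIdRigid (Over X) := by
  haveI := X.pathConnectedSpace_carrier
  haveI := X.stronglyLocallyContractibleSpace_carrier
  exact X.isIdRigid_over_of_isIdRigid_connectedCover (CovFin.isIdRigid_connected_of_isSlimGroup x₀ h)

/-! ### §3 The punctured plane `ℂ ∖ F`, `2 ≤ |F| < ∞`: unconditional -/

/-- `ℂ ∖ F` is connected for `F` finite (complement of a countable set in a real plane).
[cite: MochizukiAbsTopIII2015, Definition 4.1 (i) p.101] -/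
theorem isConnected_compl_finite {F : Set ℂ} (hF : F.Finite) : IsConnected (Fᶜ : Set ℂ) :=
  (hF.countable.isPathConnected_compl_of_one_lt_rank
    (by rw [Complex.rank_real_complex]; norm_num)).isConnected

/-- **The punctured plane `ℂ ∖ F` as an object of `HolRS`** (`F` finite): the connected open subset
`Fᶜ ⊆ ℂ` with its Riemann-surface structure (`HolRS.ofOpen`). [cite: MochizukiAbsTopIII2015, Definition 4.1 (i) p.101] -/
def planeComplFinite (F : Set ℂ) (hF : F.Finite) : HolRS :=
  ofOpen ⟨Fᶜ, hF.isClosed.isOpen_compl⟩ (isConnected_compl_finite hF)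

/-- The underlying space of `planeComplFinite F hF` is the subtype `ℂ ∖ F`. [cite: MochizukiAbsTopIII2015, Definition 4.1 (i) p.101] -/
@[simp] theorem planeComplFinite_carrier (F : Set ℂ) (hF : F.Finite) :
    (planeComplFinite F hF).carrier = ↥((⟨Fᶜ, hF.isClosed.isOpen_compl⟩ : Opens ℂ)) :=
  rfl

/-- **The slice of `HolRS` over `ℂ ∖ F` is id-rigid, unconditionally, for `F` finite with `2 ≤ |F|`**:
every automorphism of the identity functor of the category of connected holomorphic finite étale
covers of `ℂ ∖ F` over `ℂ ∖ F` is trivial (`π₁(ℂ ∖ F)` is free of rank `|F| ≥ 2`, its profinite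
completion is slim — abc-iut-w5-d144 — and (3ε)). [cite: MochizukiAbsTopIII2015, Proposition 4.2 (i) p.106] -/
theorem isIdRigid_over_planeComplFinite {F : Set ℂ} (hF : F.Finite) (h2 : 2 ≤ F.ncard) :
    IsIdRigid (Over (planeComplFinite F hF)) :=
  (planeComplFinite F hF).isIdRigid_over_of_isIdRigid_connectedCover
    (CovFin.isIdRigid_connected_compl_finite hF h2)

/-- **The thrice-punctured sphere**: the slice of `HolRS` over `ℙ¹ ∖ {0, 1, ∞} = ℂ ∖ {0, 1}` is
id-rigid, unconditionally. [cite: MochizukiAbsTopIII2015, Proposition 4.2 (i) p.106] -/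
theorem isIdRigid_over_thricePuncturedSphere :
    IsIdRigid (Over (planeComplFinite ({0, 1} : Set ℂ) (Set.toFinite _))) :=
  isIdRigid_over_planeComplFinite (Set.toFinite _) (by rw [Set.ncard_pair (zero_ne_one' ℂ)])

/-- **«Objects of `EA^hol_RS(Q)` mapping to `ℂ ∖ F`» is id-rigid modulo (H1) alone**: for `Q` closed
under finite étale covers with `ℂ ∖ F ∈ Q` (`2 ≤ |F| < ∞`), if every automorphism of `ℂ ∖ F` in
`HolRS` commuting with all its holomorphic finite étale endomorphisms is the identity, then the full
subcategory of `EA^hol_RS(Q)` of objects mapping to `ℂ ∖ F` is id-rigid — (3ε) discharged, (H1) the one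
remaining input at this object. [cite: MochizukiAbsTopIII2015, Proposition 4.2 (i) p.106] -/
theorem isIdRigid_mapsTo_planeComplFinite_of (Q : ObjectProperty HolRS) (hQ : IsCoverClosed Q)
    {F : Set ℂ} (hF : F.Finite) (h2 : 2 ≤ F.ncard) (hXQ : Q (planeComplFinite F hF))
    (h1 : ∀ a : planeComplFinite F hF ≅ planeComplFinite F hF,
      (∀ u : planeComplFinite F hF ⟶ planeComplFinite F hF, a.hom ≫ u = u ≫ a.hom) → a.hom = 𝟙 _) :
    IsIdRigid (ObjectProperty.FullSubcategory fun Y : Q.FullSubcategory =>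
      Nonempty (Y ⟶ ⟨planeComplFinite F hF, hXQ⟩)) :=
  isIdRigid_mapsTo_of_connectedCover Q hQ ⟨planeComplFinite F hF, hXQ⟩ h1
    (CovFin.isIdRigid_connected_compl_finite hF h2)

end HolRS

end Literature.AnabelianGeometry.AbsoluteAnabelian
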